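import Literature.AlgebraicGeometry.Deformation.PairLiftTwistedCocycleObstruction
import HarnessLib

/-!
# The MOVE lemma: changing the lift of the scheme by a Čech `1`-cocycle of the tangent sheaf shifts the obstruction
# cochain of an invertible sheaf by `θ ⌣ dlog g` (Sernesi (3.38); Oort §2.3 — gluing dialect of Hartshorne DT Thm. 10.2)

Layer `Literature/AlgebraicGeometry/Deformation` (cell `hodgecm-mathlib`, F-11 α1 grandchild `F11LiftWithLineBundle`, stub G2
(iii-b) «MOVE lemma» + (C1′) «pairing cup»; theorems only — no definition, no instance, no notation, no named fact).  Sequel of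
`Deformation/PairLiftTwistedCocycleObstruction` over the ring-level engine `Deformation/TwistedUnitCocycleSmallExtension`, in the
currency of `Deformation/SmoothSchemeLiftObstructionCechCocycle` (principal affine cover of the closed fibre, lifted gluing data
`ψ j l ≡ 1 (mod 𝔫')`, principal small extension `e : J ≅ k`, `t = e⁻¹ 1`; sections `θ ∈ Γ(W, 𝒯_{X/k})` as morphisms
`Ω¹|_W → 𝒪|_W`, «`θ` REPRESENTS `u`» meaning `u(1 ⊗ c) = 1 ⊗ c + t ⊗ θ(dc)`).

THE MOVE.  Given lifted gluing data `ψ` and, for every pair, an automorphism `u j l ≡ 1 (mod J)` represented by a section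
`θ j l ∈ Γ(U j ∩ U l, 𝒯)` (★ Remark 10.1.1: `u = θ_D`), the MOVED data are `ψ₂ j l := u j l · ψ j l` — «replace the lift `X′`
by `ξ · X′`, `ξ = [θ] ∈ Ȟ¹(𝔘, 𝒯) ⊗ J`».

* §1 `algEquiv_eq_of_rep_eq` (an automorphism `≡ 1 (mod J)` is determined by its representing section);
  **`movedLifts_sub_mem`** (`ψ₂ ≡ 1 (mod 𝔫')`, `J ≤ 𝔫'`); **`movedLifts_cocycle`**: if `θ` is a ČECH 1-COCYCLE
  (`θ_jl| + θ_lm| = θ_jm|`) and `ψ` is cocycle-exact (the `∀`-form of `Deformation/SmoothSchemeLiftObstructionCriterion`) then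
  `ψ₂` is cocycle-exact in the same form (★ centrality `θ_D ψ' = ψ' θ_D`, «products are represented by sums»).
* §2 **`pairObstructionCochain_move`** — THE MOVE LEMMA: if `s` is the obstruction cochain of lifted units `G ≡ 1 ⊗ g (mod 𝔫')`
  w.r.t. `ψ` (`G_{jm}|·(1 + t ⊗ s_{jlm}) = G_{jl}|·τ_{jl}(G_{lm}|)`, `τ_{jl}` the restriction of `(ψ j l)⁻¹`) and `c_{lm} g_{lm} = 1`,
  then w.r.t. `ψ₂` the SAME units have obstruction cochain
  `s_{jlm} − c_{lm}| · θ_{jl}|(d g_{lm}|)`, i.e. `s₂ = s − θ ⌣ dlog g` with the (C1′) PAIRING CUP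
  `(θ ⌣ dlog g)_{jlm} := ⟨θ_{jl}|, dlog g_{lm}|⟩` written as an explicit 2-cochain (the front∕back formula
  `(a ∪ b)_{jlm} = β(a_{jl}|, b_{lm}|)` of `Algebra/Homology/OrderedCechSystemCup`; the sign is that of `τ = ψ⁻¹`:
  `(u_θ ψ)⁻¹ = ψ⁻¹ u_{−θ}`).  [Sernesi2006 (3.38): the connecting map `H¹(T_X) → H²(𝒪_X)` of the Atiyah extension of `L`
  is `∪ c₁(L)`; Oort1971 §2.3; MFK94 App. 7A «the local structure of 𝒜_{g,δ} is quite simple».]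
* §3 **`exact_correctedUnits_of_move`**: if `s = θ ⌣ dlog g + (h_{jm}| − h_{jl}| − h_{lm}|)` then along the MOVED lift the corrected
  units `G j l + t ⊗ (g j l · h j l)` have twisted defect exactly `1` — the invertible sheaf lifts to the moved scheme
  (`Deformation/PairLiftTwistedCocycleObstruction.exact_correctedUnits_of_pairObstructionCochain_eq`).

HC_CM is proved only modulo the 7 printed citations until rung 0 closes — nothing here bears on a summit statement.

## References
* [Hartshorne2010] R. Hartshorne, *Deformation Theory*, GTM 257 (2010): Remark 10.1.1 (p. 80), Thm. 10.2 (a) proof (p. 81),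
  Thm. 6.4 (a) and proof (pp. 50–51).
* [Sernesi2006] E. Sernesi, *Deformations of Algebraic Schemes*, Grundlehren 334 (2006), Thm. 3.3.11 and (3.38).
* [Oort1971] F. Oort, *Finite group schemes, local moduli for abelian varieties, and lifting problems*, Compositio Math. 23
  (1971), §2.3.
-/

noncomputable section

-- `TopCat.Presheaf`/`TopCat.Sheaf` are not reducible (as in Mathlib's `AlgebraicGeometry/Modules`).
set_option backward.isDefEq.respectTransparency false

open CategoryTheory AlgebraicGeometry Opposite TopologicalSpace
open scoped TensorProduct

universe u

namespace Literature.AlgebraicGeometry.Deformation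

open Literature.AlgebraicGeometry.HodgeTheory Literature.AlgebraicGeometry.Modules
  Literature.AlgebraicGeometry.Motives Literature.AlgebraicGeometry.Morphisms SmoothAffineDeformation

variable {k : Type u} [Field k] {X : Over (Spec (CommRingCat.of k))}
  [instΓ : ∀ W : X.left.Opens, Algebra k Γ(X.left, W)]
  (halg : ∀ (W : X.left.Opens) (s : k), algebraMap k Γ(X.left, W) s = (constToPresheaf X).app (op W) s)
  {A' : Type u} [CommRing A'] [Algebra k A']

/-! ## §1 Moved lifts are admissible -/

section Admissible

variable (J : Ideal A') (hJ : J * J = ⊥) (e : ↥(J.restrictScalars k) ≃ₗ[k] k)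

include hJ in
/-- **An automorphism `≡ 1 (mod J)` is determined by its representing section** (both are `θ_D` for the derivation read off
the section, ★ Remark 10.1.1). [cite: Hartshorne2010, Remark 10.1.1, p. 80] -/
theorem algEquiv_eq_of_rep_eq {W : X.left.Opens} {u v : A' ⊗[k] Γ(X.left, W) ≃ₐ[A'] A' ⊗[k] Γ(X.left, W)}
    (hu : ∀ x, u x - x ∈ J • (⊤ : Submodule A' (A' ⊗[k] Γ(X.left, W))))
    (hv : ∀ x, v x - x ∈ J • (⊤ : Submodule A' (A' ⊗[k] Γ(X.left, W))))
    {θ : (cotangentSheaf X).over W ⟶ (unitModule X.left).over W}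
    (hθu : ∀ c : Γ(X.left, W), u ((1 : A') ⊗ₜ c) =
        (1 : A') ⊗ₜ c + ((e.symm 1 : ↥(J.restrictScalars k)) : A') ⊗ₜ
          (show Γ(X.left, W) from appLE θ (𝟙 W) (dSection X W c)))
    (hθv : ∀ c : Γ(X.left, W), v ((1 : A') ⊗ₜ c) =
        (1 : A') ⊗ₜ c + ((e.symm 1 : ↥(J.restrictScalars k)) : A') ⊗ₜ
          (show Γ(X.left, W) from appLE θ (𝟙 W) (dSection X W c))) : u = v := by
  obtain ⟨D, hD⟩ := (exists_eq_infinitesimalAut_iff J hJ u).2 hu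
  obtain ⟨D', hD'⟩ := (exists_eq_infinitesimalAut_iff J hJ v).2 hv
  have hDD' : D = D' := Derivation.ext fun c => by
    rw [(rep_iff_forall_eq_tmul J hJ e hD θ).1 hθu c, (rep_iff_forall_eq_tmul J hJ e hD' θ).1 hθv c]
  rw [← hD, ← hD', hDD']

variable {ι : Type u} (U : ι → X.left.affineOpens) (b : (j l : ι) → Γ(X.left, (U j).1))
  (hb : ∀ j l, (U j).1 ⊓ (U l).1 = X.left.basicOpen (b j l)) (𝔫' : Ideal A')

omit instΓ in
/-- **Moved lifts induce the identity modulo `𝔫'`** (`J ≤ 𝔫'`). [cite: Hartshorne2010, Thm. 10.2 (proof), p. 81] -/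
theorem movedLifts_sub_mem (hJle : J ≤ 𝔫') {R : Type*} [CommRing R] [Algebra A' R]
    {u ψ : R ≃ₐ[A'] R} (hu : ∀ x, u x - x ∈ J • (⊤ : Submodule A' R))
    (hψ : ∀ x, ψ x - x ∈ 𝔫' • (⊤ : Submodule A' R)) (x : R) : (u * ψ) x - x ∈ 𝔫' • (⊤ : Submodule A' R) := by
  have h : (u * ψ) x - x = (u (ψ x) - ψ x) + (ψ x - x) := by rw [AlgEquiv.mul_apply]; abel
  rw [h]
  exact Submodule.add_mem _ (Submodule.smul_mono hJle le_rfl (hu (ψ x))) (hψ x)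

include halg hb hJ in
/-- **Moved lifts are COCYCLE-EXACT when the moving sections form a Čech 1-cocycle.**  If `ψ` is cocycle-exact (the `∀`-form:
characterised restrictions compose on triple overlaps), `u j l ≡ 1 (mod J)` is represented by `θ j l`, and
`θ_jl| + θ_lm| = θ_jm|` on every `U j ∩ U l ∩ U m`, then `ψ₂ := u · ψ` is cocycle-exact in the same form.  (Restrictions of `u ψ`
are `u' ρ` with `u'` represented by `θ|`; `u'_lm ρ_lm u'_jl ρ_jl = u'_lm u'_jl ρ_lm ρ_jl` by ★ centrality; `u'_lm u'_jl` is represented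
by `θ_lm| + θ_jl| = θ_jm|`, hence equals `u'_jm`.) [cite: Hartshorne2010, Remark 10.1.1 and Thm. 10.2 (proof), p. 81] -/
theorem movedLifts_cocycle (h𝔫 : IsNilpotent 𝔫') (hJ𝔫 : J * 𝔫' = ⊥)
    (ψ : (j l : ι) → A' ⊗[k] Γ(X.left, (U j).1 ⊓ (U l).1) ≃ₐ[A'] A' ⊗[k] Γ(X.left, (U j).1 ⊓ (U l).1))
    (hψ : ∀ j l x, ψ j l x - x ∈ 𝔫' • (⊤ : Submodule A' (A' ⊗[k] Γ(X.left, (U j).1 ⊓ (U l).1))))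
    (hcocψ : ∀ (j l m : ι)
      (Φjl : A' ⊗[k] Γ(X.left, (U j).1 ⊓ (U l).1) →ₐ[A'] A' ⊗[k] Γ(X.left, (U j).1 ⊓ (U l).1 ⊓ (U m).1))
      (_ : ∀ a s, Φjl (a ⊗ₜ s) = a ⊗ₜ X.left.presheaf.map (homOfLE inf_le_left).op s)
      (Φlm : A' ⊗[k] Γ(X.left, (U l).1 ⊓ (U m).1) →ₐ[A'] A' ⊗[k] Γ(X.left, (U j).1 ⊓ (U l).1 ⊓ (U m).1))
      (_ : ∀ a s, Φlm (a ⊗ₜ s) = a ⊗ₜ X.left.presheaf.map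
        (homOfLE (le_inf (inf_le_left.trans inf_le_right) inf_le_right)).op s)
      (Φjm : A' ⊗[k] Γ(X.left, (U j).1 ⊓ (U m).1) →ₐ[A'] A' ⊗[k] Γ(X.left, (U j).1 ⊓ (U l).1 ⊓ (U m).1))
      (_ : ∀ a s, Φjm (a ⊗ₜ s) = a ⊗ₜ X.left.presheaf.map
        (homOfLE (le_inf (inf_le_left.trans inf_le_left) inf_le_right)).op s)
      (ρjl ρlm ρjm : A' ⊗[k] Γ(X.left, (U j).1 ⊓ (U l).1 ⊓ (U m).1) ≃ₐ[A']
        A' ⊗[k] Γ(X.left, (U j).1 ⊓ (U l).1 ⊓ (U m).1)),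
      (∀ x, ρjl (Φjl x) = Φjl (ψ j l x)) → (∀ x, ρlm (Φlm x) = Φlm (ψ l m x)) →
      (∀ x, ρjm (Φjm x) = Φjm (ψ j m x)) → ρlm * ρjl = ρjm)
    (u : (j l : ι) → A' ⊗[k] Γ(X.left, (U j).1 ⊓ (U l).1) ≃ₐ[A'] A' ⊗[k] Γ(X.left, (U j).1 ⊓ (U l).1))
    (hu : ∀ j l x, u j l x - x ∈ J • (⊤ : Submodule A' (A' ⊗[k] Γ(X.left, (U j).1 ⊓ (U l).1))))
    (θ : (j l : ι) → ((cotangentSheaf X).over ((U j).1 ⊓ (U l).1) ⟶ (unitModule X.left).over ((U j).1 ⊓ (U l).1)))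
    (hθ : ∀ j l (c : Γ(X.left, (U j).1 ⊓ (U l).1)), u j l ((1 : A') ⊗ₜ c) =
        (1 : A') ⊗ₜ c + ((e.symm 1 : ↥(J.restrictScalars k)) : A') ⊗ₜ
          (show Γ(X.left, (U j).1 ⊓ (U l).1) from appLE (θ j l) (𝟙 _) (dSection X _ c)))
    (hθcoc : ∀ j l m : ι,
      restrictHom (homOfLE (inf_le_left : (U j).1 ⊓ (U l).1 ⊓ (U m).1 ≤ (U j).1 ⊓ (U l).1)) (θ j l) +
        restrictHom (homOfLE (le_inf (inf_le_left.trans inf_le_right) inf_le_right :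
          (U j).1 ⊓ (U l).1 ⊓ (U m).1 ≤ (U l).1 ⊓ (U m).1)) (θ l m) =
        restrictHom (homOfLE (le_inf (inf_le_left.trans inf_le_left) inf_le_right :
          (U j).1 ⊓ (U l).1 ⊓ (U m).1 ≤ (U j).1 ⊓ (U m).1)) (θ j m)) :
    ∀ (j l m : ι)
      (Φjl : A' ⊗[k] Γ(X.left, (U j).1 ⊓ (U l).1) →ₐ[A'] A' ⊗[k] Γ(X.left, (U j).1 ⊓ (U l).1 ⊓ (U m).1))
      (_ : ∀ a s, Φjl (a ⊗ₜ s) = a ⊗ₜ X.left.presheaf.map (homOfLE inf_le_left).op s)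
      (Φlm : A' ⊗[k] Γ(X.left, (U l).1 ⊓ (U m).1) →ₐ[A'] A' ⊗[k] Γ(X.left, (U j).1 ⊓ (U l).1 ⊓ (U m).1))
      (_ : ∀ a s, Φlm (a ⊗ₜ s) = a ⊗ₜ X.left.presheaf.map
        (homOfLE (le_inf (inf_le_left.trans inf_le_right) inf_le_right)).op s)
      (Φjm : A' ⊗[k] Γ(X.left, (U j).1 ⊓ (U m).1) →ₐ[A'] A' ⊗[k] Γ(X.left, (U j).1 ⊓ (U l).1 ⊓ (U m).1))
      (_ : ∀ a s, Φjm (a ⊗ₜ s) = a ⊗ₜ X.left.presheaf.map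
        (homOfLE (le_inf (inf_le_left.trans inf_le_left) inf_le_right)).op s)
      (ρjl ρlm ρjm : A' ⊗[k] Γ(X.left, (U j).1 ⊓ (U l).1 ⊓ (U m).1) ≃ₐ[A']
        A' ⊗[k] Γ(X.left, (U j).1 ⊓ (U l).1 ⊓ (U m).1)),
      (∀ x, ρjl (Φjl x) = Φjl ((u j l * ψ j l) x)) → (∀ x, ρlm (Φlm x) = Φlm ((u l m * ψ l m) x)) →
      (∀ x, ρjm (Φjm x) = Φjm ((u j m * ψ j m) x)) → ρlm * ρjl = ρjm := by
  intro j l m Φjl hΦjl Φlm hΦlm Φjm hΦjm ρ₂jl ρ₂lm ρ₂jm hρ₂jl hρ₂lm hρ₂jm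
  have hJnil : IsNilpotent J := ⟨2, by rw [pow_two, hJ]; rfl⟩
  -- the three triple intersections as principal opens
  have hW₃jl : (U j).1 ⊓ (U l).1 ⊓ (U m).1 =
      X.left.basicOpen (X.left.presheaf.map (homOfLE (inf_le_left : (U j).1 ⊓ (U l).1 ≤ (U j).1)).op (b j m)) :=
    inf_eq_basicOpen_map U b hb inf_le_left m
  have hW₃lm : (U j).1 ⊓ (U l).1 ⊓ (U m).1 =
      X.left.basicOpen (X.left.presheaf.map (homOfLE (inf_le_left : (U l).1 ⊓ (U m).1 ≤ (U l).1)).op (b l j)) := by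
    rw [← inf_eq_basicOpen_map U b hb inf_le_left j]; ac_rfl
  have hW₃jm : (U j).1 ⊓ (U l).1 ⊓ (U m).1 =
      X.left.basicOpen (X.left.presheaf.map (homOfLE (inf_le_left : (U j).1 ⊓ (U m).1 ≤ (U j).1)).op (b j l)) := by
    rw [← inf_eq_basicOpen_map U b hb inf_le_left l]; ac_rfl
  -- restrictions of the `ψ` (mod `𝔫'`) and of the `u` (mod `J`)
  obtain ⟨ρjl, hρjl, -⟩ := exists_algEquiv_restrict halg 𝔫' (isAffineOpen_inf₂ U b hb j l) _ hW₃jl inf_le_left h𝔫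
    (ψ j l) (hψ j l) hΦjl
  obtain ⟨ρlm, hρlm, hρlm𝔫⟩ := exists_algEquiv_restrict halg 𝔫' (isAffineOpen_inf₂ U b hb l m) _ hW₃lm
    (le_inf (inf_le_left.trans inf_le_right) inf_le_right) h𝔫 (ψ l m) (hψ l m) hΦlm
  obtain ⟨ρjm, hρjm, -⟩ := exists_algEquiv_restrict halg 𝔫' (isAffineOpen_inf₂ U b hb j m) _ hW₃jm
    (le_inf (inf_le_left.trans inf_le_left) inf_le_right) h𝔫 (ψ j m) (hψ j m) hΦjm
  obtain ⟨vjl, hvjl, hvjlJ⟩ := exists_algEquiv_restrict halg J (isAffineOpen_inf₂ U b hb j l) _ hW₃jl inf_le_left hJnil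
    (u j l) (hu j l) hΦjl
  obtain ⟨vlm, hvlm, hvlmJ⟩ := exists_algEquiv_restrict halg J (isAffineOpen_inf₂ U b hb l m) _ hW₃lm
    (le_inf (inf_le_left.trans inf_le_right) inf_le_right) hJnil (u l m) (hu l m) hΦlm
  obtain ⟨vjm, hvjm, hvjmJ⟩ := exists_algEquiv_restrict halg J (isAffineOpen_inf₂ U b hb j m) _ hW₃jm
    (le_inf (inf_le_left.trans inf_le_left) inf_le_right) hJnil (u j m) (hu j m) hΦjm
  -- the restrictions of the moved data are `v · ρ`
  have eρ₂jl : ρ₂jl = vjl * ρjl := algEquiv_restrict_unique halg (isAffineOpen_inf₂ U b hb j l) _ hW₃jl inf_le_left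
    (u j l * ψ j l) hΦjl hρ₂jl (algEquiv_restrict_mul hvjl hρjl)
  have eρ₂lm : ρ₂lm = vlm * ρlm := algEquiv_restrict_unique halg (isAffineOpen_inf₂ U b hb l m) _ hW₃lm
    (le_inf (inf_le_left.trans inf_le_right) inf_le_right) (u l m * ψ l m) hΦlm hρ₂lm (algEquiv_restrict_mul hvlm hρlm)
  have eρ₂jm : ρ₂jm = vjm * ρjm := algEquiv_restrict_unique halg (isAffineOpen_inf₂ U b hb j m) _ hW₃jm
    (le_inf (inf_le_left.trans inf_le_left) inf_le_right) (u j m * ψ j m) hΦjm hρ₂jm (algEquiv_restrict_mul hvjm hρjm)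
  -- the `v`'s are represented by the restricted sections
  have rjl := tangentSheaf_section_rep_restrict halg J hJ e (isAffineOpen_inf₂ U b hb j l) _ hW₃jl inf_le_left (hθ j l)
    hΦjl hvjl hvjlJ
  have rlm := tangentSheaf_section_rep_restrict halg J hJ e (isAffineOpen_inf₂ U b hb l m) _ hW₃lm
    (le_inf (inf_le_left.trans inf_le_right) inf_le_right) (hθ l m) hΦlm hvlm hvlmJ
  have rjm := tangentSheaf_section_rep_restrict halg J hJ e (isAffineOpen_inf₂ U b hb j m) _ hW₃jm
    (le_inf (inf_le_left.trans inf_le_left) inf_le_right) (hθ j m) hΦjm hvjm hvjmJ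
  -- `vlm vjl = vjm`: both `≡ 1 (mod J)` and represented by `θ_lm| + θ_jl| = θ_jm|`
  have hvv : vlm * vjl = vjm := by
    have rprod := tangentSheaf_section_rep_mul J hJ e hvlmJ hvjlJ rlm rjl
    rw [add_comm, hθcoc j l m] at rprod
    exact algEquiv_eq_of_rep_eq J hJ e (movedLifts_sub_mem J J le_rfl hvlmJ hvjlJ) hvjmJ rprod rjm
  -- centrality: `ρlm vjl = vjl ρlm`
  obtain ⟨D, hD⟩ := (exists_eq_infinitesimalAut_iff J hJ vjl).2 hvjlJ
  have hcomm : ρlm * vjl = vjl * ρlm := by rw [← hD, infinitesimalAut_mul_comm J hJ hJ𝔫 ρlm hρlm𝔫 D]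
  -- assemble
  rw [eρ₂jl, eρ₂lm, eρ₂jm, mul_assoc, ← mul_assoc ρlm, hcomm, mul_assoc, hcocψ j l m Φjl hΦjl Φlm hΦlm Φjm hΦjm ρjl ρlm
    ρjm hρjl hρlm hρjm, ← mul_assoc, hvv]

end Admissible

/-! ## §2 The move lemma -/

section Move

variable (J : Ideal A') (hJ : J * J = ⊥) (e : ↥(J.restrictScalars k) ≃ₗ[k] k)
  {ι : Type u} (U : ι → X.left.affineOpens) (b : (j l : ι) → Γ(X.left, (U j).1))
  (hb : ∀ j l, (U j).1 ⊓ (U l).1 = X.left.basicOpen (b j l)) (𝔫' : Ideal A')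

include halg hb hJ in
/-- **THE MOVE LEMMA** («the obstruction to lifting the invertible sheaf changes by the cup product of the class of the
change of lift with `dlog` of its transition functions»).  Let `s` be the obstruction cochain of lifted units
`G ≡ 1 ⊗ g (mod 𝔫')` w.r.t. lifted gluing data `ψ` (closed-fibre cocycle `g_jl| g_lm| = g_jm|`, inverses `gi`), and move the
data to `ψ₂ := u · ψ` with `u j l ≡ 1 (mod J)` represented by `θ j l ∈ Γ(U j ∩ U l, 𝒯)`.  Then, for the SAME units and ALL
characterised base changes and restrictions `τ₂` of `(ψ₂ j l)⁻¹`: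
`G_{jm}| · (1 + t ⊗ (s_{jlm} − gi_{lm}| · θ_{jl}|(d g_{lm}|))) = G_{jl}| · τ₂(G_{lm}|)` — the obstruction cochain of the pair
w.r.t. the moved lift is `s − θ ⌣ dlog g`, with the pairing cup `(θ ⌣ dlog g)_{jlm} = ⟨θ_{jl}|, g_{lm}|⁻¹ d g_{lm}|⟩`
(engine `twistedDefect_move_of_cocycle`; the sign is that of `τ = ψ⁻¹`: `(θ_D ρ)⁻¹ = ρ⁻¹ θ_{−D}`).
[cite: Sernesi2006, Thm. 3.3.11 and (3.38)] [cite: Oort1971, §2.3] [cite: Hartshorne2010, Remark 10.1.1, p. 80] -/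
theorem pairObstructionCochain_move (h𝔫 : IsNilpotent 𝔫') (hJ𝔫 : J * 𝔫' = ⊥)
    (ψ : (j l : ι) → A' ⊗[k] Γ(X.left, (U j).1 ⊓ (U l).1) ≃ₐ[A'] A' ⊗[k] Γ(X.left, (U j).1 ⊓ (U l).1))
    (hψ : ∀ j l x, ψ j l x - x ∈ 𝔫' • (⊤ : Submodule A' (A' ⊗[k] Γ(X.left, (U j).1 ⊓ (U l).1))))
    (u : (j l : ι) → A' ⊗[k] Γ(X.left, (U j).1 ⊓ (U l).1) ≃ₐ[A'] A' ⊗[k] Γ(X.left, (U j).1 ⊓ (U l).1))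
    (hu : ∀ j l x, u j l x - x ∈ J • (⊤ : Submodule A' (A' ⊗[k] Γ(X.left, (U j).1 ⊓ (U l).1))))
    (θ : (j l : ι) → ((cotangentSheaf X).over ((U j).1 ⊓ (U l).1) ⟶ (unitModule X.left).over ((U j).1 ⊓ (U l).1)))
    (hθ : ∀ j l (c : Γ(X.left, (U j).1 ⊓ (U l).1)), u j l ((1 : A') ⊗ₜ c) =
        (1 : A') ⊗ₜ c + ((e.symm 1 : ↥(J.restrictScalars k)) : A') ⊗ₜ
          (show Γ(X.left, (U j).1 ⊓ (U l).1) from appLE (θ j l) (𝟙 _) (dSection X _ c)))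
    (G : (j l : ι) → A' ⊗[k] Γ(X.left, (U j).1 ⊓ (U l).1)) (g gi : (j l : ι) → Γ(X.left, (U j).1 ⊓ (U l).1))
    (hgi : ∀ j l, g j l * gi j l = 1)
    (hG : ∀ j l, G j l - (1 : A') ⊗ₜ g j l ∈ 𝔫' • (⊤ : Submodule A' (A' ⊗[k] Γ(X.left, (U j).1 ⊓ (U l).1))))
    (hgcoc : ∀ j l m : ι,
      X.left.presheaf.map (homOfLE (inf_le_left : (U j).1 ⊓ (U l).1 ⊓ (U m).1 ≤ (U j).1 ⊓ (U l).1)).op (g j l) *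
        X.left.presheaf.map (homOfLE (le_inf (inf_le_left.trans inf_le_right) inf_le_right :
          (U j).1 ⊓ (U l).1 ⊓ (U m).1 ≤ (U l).1 ⊓ (U m).1)).op (g l m) =
        X.left.presheaf.map (homOfLE (le_inf (inf_le_left.trans inf_le_left) inf_le_right :
          (U j).1 ⊓ (U l).1 ⊓ (U m).1 ≤ (U j).1 ⊓ (U m).1)).op (g j m))
    (s : (j l m : ι) → Γ(X.left, (U j).1 ⊓ (U l).1 ⊓ (U m).1))
    (hs : ∀ (j l m : ι)
      (Φjl : A' ⊗[k] Γ(X.left, (U j).1 ⊓ (U l).1) →ₐ[A'] A' ⊗[k] Γ(X.left, (U j).1 ⊓ (U l).1 ⊓ (U m).1))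
      (_ : ∀ a s, Φjl (a ⊗ₜ s) = a ⊗ₜ X.left.presheaf.map (homOfLE inf_le_left).op s)
      (Φlm : A' ⊗[k] Γ(X.left, (U l).1 ⊓ (U m).1) →ₐ[A'] A' ⊗[k] Γ(X.left, (U j).1 ⊓ (U l).1 ⊓ (U m).1))
      (_ : ∀ a s, Φlm (a ⊗ₜ s) = a ⊗ₜ X.left.presheaf.map
        (homOfLE (le_inf (inf_le_left.trans inf_le_right) inf_le_right)).op s)
      (Φjm : A' ⊗[k] Γ(X.left, (U j).1 ⊓ (U m).1) →ₐ[A'] A' ⊗[k] Γ(X.left, (U j).1 ⊓ (U l).1 ⊓ (U m).1))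
      (_ : ∀ a s, Φjm (a ⊗ₜ s) = a ⊗ₜ X.left.presheaf.map
        (homOfLE (le_inf (inf_le_left.trans inf_le_left) inf_le_right)).op s)
      (τjl : A' ⊗[k] Γ(X.left, (U j).1 ⊓ (U l).1 ⊓ (U m).1) ≃ₐ[A'] A' ⊗[k] Γ(X.left, (U j).1 ⊓ (U l).1 ⊓ (U m).1)),
      (∀ x, τjl (Φjl (ψ j l x)) = Φjl x) →
      Φjm (G j m) * (1 + ((e.symm 1 : ↥(J.restrictScalars k)) : A') ⊗ₜ s j l m) = Φjl (G j l) * τjl (Φlm (G l m))) :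
    ∀ (j l m : ι)
      (Φjl : A' ⊗[k] Γ(X.left, (U j).1 ⊓ (U l).1) →ₐ[A'] A' ⊗[k] Γ(X.left, (U j).1 ⊓ (U l).1 ⊓ (U m).1))
      (_ : ∀ a s, Φjl (a ⊗ₜ s) = a ⊗ₜ X.left.presheaf.map (homOfLE inf_le_left).op s)
      (Φlm : A' ⊗[k] Γ(X.left, (U l).1 ⊓ (U m).1) →ₐ[A'] A' ⊗[k] Γ(X.left, (U j).1 ⊓ (U l).1 ⊓ (U m).1))
      (_ : ∀ a s, Φlm (a ⊗ₜ s) = a ⊗ₜ X.left.presheaf.map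
        (homOfLE (le_inf (inf_le_left.trans inf_le_right) inf_le_right)).op s)
      (Φjm : A' ⊗[k] Γ(X.left, (U j).1 ⊓ (U m).1) →ₐ[A'] A' ⊗[k] Γ(X.left, (U j).1 ⊓ (U l).1 ⊓ (U m).1))
      (_ : ∀ a s, Φjm (a ⊗ₜ s) = a ⊗ₜ X.left.presheaf.map
        (homOfLE (le_inf (inf_le_left.trans inf_le_left) inf_le_right)).op s)
      (τjl : A' ⊗[k] Γ(X.left, (U j).1 ⊓ (U l).1 ⊓ (U m).1) ≃ₐ[A'] A' ⊗[k] Γ(X.left, (U j).1 ⊓ (U l).1 ⊓ (U m).1)),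
      (∀ x, τjl (Φjl ((u j l * ψ j l) x)) = Φjl x) →
      Φjm (G j m) * (1 + ((e.symm 1 : ↥(J.restrictScalars k)) : A') ⊗ₜ (s j l m -
        X.left.presheaf.map (homOfLE (le_inf (inf_le_left.trans inf_le_right) inf_le_right :
            (U j).1 ⊓ (U l).1 ⊓ (U m).1 ≤ (U l).1 ⊓ (U m).1)).op (gi l m) *
          (show Γ(X.left, (U j).1 ⊓ (U l).1 ⊓ (U m).1) from
            appLE (restrictHom (homOfLE (inf_le_left : (U j).1 ⊓ (U l).1 ⊓ (U m).1 ≤ (U j).1 ⊓ (U l).1)) (θ j l)) (𝟙 _)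
              (dSection X _ (X.left.presheaf.map (homOfLE (le_inf (inf_le_left.trans inf_le_right) inf_le_right :
                (U j).1 ⊓ (U l).1 ⊓ (U m).1 ≤ (U l).1 ⊓ (U m).1)).op (g l m)))))) =
        Φjl (G j l) * τjl (Φlm (G l m)) := by
  intro j l m Φjl hΦjl Φlm hΦlm Φjm hΦjm τ₂ hτ₂
  have hJnil : IsNilpotent J := ⟨2, by rw [pow_two, hJ]; rfl⟩
  have hW₃jl : (U j).1 ⊓ (U l).1 ⊓ (U m).1 =
      X.left.basicOpen (X.left.presheaf.map (homOfLE (inf_le_left : (U j).1 ⊓ (U l).1 ≤ (U j).1)).op (b j m)) :=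
    inf_eq_basicOpen_map U b hb inf_le_left m
  -- the restriction of `ψ j l` and its inverse `τ`
  obtain ⟨ρjl, hρjl, hρjl𝔫⟩ := exists_algEquiv_restrict halg 𝔫' (isAffineOpen_inf₂ U b hb j l) _ hW₃jl inf_le_left h𝔫
    (ψ j l) (hψ j l) hΦjl
  have hτ : ∀ x, ρjl⁻¹ (Φjl (ψ j l x)) = Φjl x := restrict_symm_iff.2 (algEquiv_restrict_inv hρjl)
  have hτ𝔫 : ∀ y, ρjl⁻¹ y - y ∈ 𝔫' • (⊤ : Submodule A' (A' ⊗[k] Γ(X.left, (U j).1 ⊓ (U l).1 ⊓ (U m).1))) := fun y => by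
    have hy : ρjl⁻¹ y - y = -(ρjl (ρjl⁻¹ y) - ρjl⁻¹ y) := by
      rw [AlgEquiv.aut_inv, AlgEquiv.apply_symm_apply, neg_sub]
    rw [hy]
    exact Submodule.neg_mem _ (hρjl𝔫 _)
  -- the restriction `v = θ_D` of `u j l`, represented by `θ j l|`
  obtain ⟨v, hv, hvJ⟩ := exists_algEquiv_restrict halg J (isAffineOpen_inf₂ U b hb j l) _ hW₃jl inf_le_left hJnil
    (u j l) (hu j l) hΦjl
  have r := tangentSheaf_section_rep_restrict halg J hJ e (isAffineOpen_inf₂ U b hb j l) _ hW₃jl inf_le_left (hθ j l)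
    hΦjl hv hvJ
  obtain ⟨D, hD⟩ := (exists_eq_infinitesimalAut_iff J hJ v).2 hvJ
  have hDrep := (rep_iff_forall_eq_tmul J hJ e hD _).1 r
  -- the restriction of `(ψ₂ j l)⁻¹` is `θ_{−D} τ`
  have hcomm : v * ρjl⁻¹ = ρjl⁻¹ * v := by rw [← hD, infinitesimalAut_mul_comm J hJ hJ𝔫 ρjl⁻¹ hτ𝔫 D]
  have hinv : infinitesimalAut J hJ (-D) * infinitesimalAut J hJ D = 1 := by
    rw [infinitesimalAut_neg, inv_mul_cancel]
  have hτ₂' : ∀ x, (infinitesimalAut J hJ (-D) * ρjl⁻¹) (Φjl ((u j l * ψ j l) x)) = Φjl x := fun x => by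
    rw [AlgEquiv.mul_apply, AlgEquiv.mul_apply, ← hv, ← AlgEquiv.mul_apply (ρjl⁻¹), ← hcomm, AlgEquiv.mul_apply, hτ,
      ← hD, ← AlgEquiv.mul_apply, hinv, AlgEquiv.one_apply]
  have eτ₂ : τ₂ = infinitesimalAut J hJ (-D) * ρjl⁻¹ :=
    algEquiv_restrict_symm_unique halg (isAffineOpen_inf₂ U b hb j l) _ hW₃jl inf_le_left (u j l * ψ j l) hΦjl hτ₂ hτ₂'
  -- the engine
  have hc : X.left.presheaf.map (homOfLE (le_inf (inf_le_left.trans inf_le_right) inf_le_right :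
        (U j).1 ⊓ (U l).1 ⊓ (U m).1 ≤ (U l).1 ⊓ (U m).1)).op (g l m) *
      X.left.presheaf.map (homOfLE (le_inf (inf_le_left.trans inf_le_right) inf_le_right :
        (U j).1 ⊓ (U l).1 ⊓ (U m).1 ≤ (U l).1 ⊓ (U m).1)).op (gi l m) = 1 := by
    rw [← map_mul, hgi, map_one]
  have key := twistedDefect_move_of_cocycle J hJ hJ𝔫 (-D) ρjl⁻¹ hτ𝔫 (baseChangeMap_sub_tmul_mem _ hΦjm (hG j m))
    (baseChangeMap_sub_tmul_mem _ hΦjl (hG j l)) (baseChangeMap_sub_tmul_mem _ hΦlm (hG l m))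
    (hs j l m Φjl hΦjl Φlm hΦlm Φjm hΦjm ρjl⁻¹ hτ) (hgcoc j l m) hc
  rw [Derivation.neg_apply, hDrep, smul_neg, TensorProduct.smul_tmul', smul_eq_mul, map_neg, idealTensorIncl_tmul, add_assoc,
    ← sub_eq_add_neg, ← TensorProduct.tmul_sub] at key
  rw [eτ₂]
  exact key

include halg hb hJ in
/-- **Along the moved lift the invertible sheaf lifts when `s = θ ⌣ dlog g +` a coboundary.**  With the data of
`pairObstructionCochain_move`, `J ≤ 𝔫'`, and `s_{jlm} = gi_{lm}|·θ_{jl}|(d g_{lm}|) + (h_{jm}| − h_{jl}| − h_{lm}|)`: w.r.t.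
`ψ₂ = u · ψ` the corrected units `G j l + t ⊗ (g j l · h j l)` are `≡ 1 ⊗ g (mod 𝔫')` and have twisted defect EXACTLY `1`
(`exact_correctedUnits_of_pairObstructionCochain_eq` for the moved data).  This is the step «choose the lift of the scheme
so that `L` extends» of [Oort1971] §2.3 ∕ [MFK94] App. 7A, once `θ` with `[s] = [θ ⌣ dlog g]` is supplied by the cup-product
surjectivity. [cite: Oort1971, §2.3] [cite: Hartshorne2010, Thm. 6.4 (a) and proof, pp. 50–51] -/
theorem exact_correctedUnits_of_move (h𝔫 : IsNilpotent 𝔫') (hJ𝔫 : J * 𝔫' = ⊥) (hJle : J ≤ 𝔫')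
    (ψ : (j l : ι) → A' ⊗[k] Γ(X.left, (U j).1 ⊓ (U l).1) ≃ₐ[A'] A' ⊗[k] Γ(X.left, (U j).1 ⊓ (U l).1))
    (hψ : ∀ j l x, ψ j l x - x ∈ 𝔫' • (⊤ : Submodule A' (A' ⊗[k] Γ(X.left, (U j).1 ⊓ (U l).1))))
    (u : (j l : ι) → A' ⊗[k] Γ(X.left, (U j).1 ⊓ (U l).1) ≃ₐ[A'] A' ⊗[k] Γ(X.left, (U j).1 ⊓ (U l).1))
    (hu : ∀ j l x, u j l x - x ∈ J • (⊤ : Submodule A' (A' ⊗[k] Γ(X.left, (U j).1 ⊓ (U l).1))))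
    (θ : (j l : ι) → ((cotangentSheaf X).over ((U j).1 ⊓ (U l).1) ⟶ (unitModule X.left).over ((U j).1 ⊓ (U l).1)))
    (hθ : ∀ j l (c : Γ(X.left, (U j).1 ⊓ (U l).1)), u j l ((1 : A') ⊗ₜ c) =
        (1 : A') ⊗ₜ c + ((e.symm 1 : ↥(J.restrictScalars k)) : A') ⊗ₜ
          (show Γ(X.left, (U j).1 ⊓ (U l).1) from appLE (θ j l) (𝟙 _) (dSection X _ c)))
    (G : (j l : ι) → A' ⊗[k] Γ(X.left, (U j).1 ⊓ (U l).1)) (g gi : (j l : ι) → Γ(X.left, (U j).1 ⊓ (U l).1))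
    (hgi : ∀ j l, g j l * gi j l = 1)
    (hG : ∀ j l, G j l - (1 : A') ⊗ₜ g j l ∈ 𝔫' • (⊤ : Submodule A' (A' ⊗[k] Γ(X.left, (U j).1 ⊓ (U l).1))))
    (hgcoc : ∀ j l m : ι,
      X.left.presheaf.map (homOfLE (inf_le_left : (U j).1 ⊓ (U l).1 ⊓ (U m).1 ≤ (U j).1 ⊓ (U l).1)).op (g j l) *
        X.left.presheaf.map (homOfLE (le_inf (inf_le_left.trans inf_le_right) inf_le_right :
          (U j).1 ⊓ (U l).1 ⊓ (U m).1 ≤ (U l).1 ⊓ (U m).1)).op (g l m) =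
        X.left.presheaf.map (homOfLE (le_inf (inf_le_left.trans inf_le_left) inf_le_right :
          (U j).1 ⊓ (U l).1 ⊓ (U m).1 ≤ (U j).1 ⊓ (U m).1)).op (g j m))
    (s : (j l m : ι) → Γ(X.left, (U j).1 ⊓ (U l).1 ⊓ (U m).1))
    (hs : ∀ (j l m : ι)
      (Φjl : A' ⊗[k] Γ(X.left, (U j).1 ⊓ (U l).1) →ₐ[A'] A' ⊗[k] Γ(X.left, (U j).1 ⊓ (U l).1 ⊓ (U m).1))
      (_ : ∀ a s, Φjl (a ⊗ₜ s) = a ⊗ₜ X.left.presheaf.map (homOfLE inf_le_left).op s)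
      (Φlm : A' ⊗[k] Γ(X.left, (U l).1 ⊓ (U m).1) →ₐ[A'] A' ⊗[k] Γ(X.left, (U j).1 ⊓ (U l).1 ⊓ (U m).1))
      (_ : ∀ a s, Φlm (a ⊗ₜ s) = a ⊗ₜ X.left.presheaf.map
        (homOfLE (le_inf (inf_le_left.trans inf_le_right) inf_le_right)).op s)
      (Φjm : A' ⊗[k] Γ(X.left, (U j).1 ⊓ (U m).1) →ₐ[A'] A' ⊗[k] Γ(X.left, (U j).1 ⊓ (U l).1 ⊓ (U m).1))
      (_ : ∀ a s, Φjm (a ⊗ₜ s) = a ⊗ₜ X.left.presheaf.map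
        (homOfLE (le_inf (inf_le_left.trans inf_le_left) inf_le_right)).op s)
      (τjl : A' ⊗[k] Γ(X.left, (U j).1 ⊓ (U l).1 ⊓ (U m).1) ≃ₐ[A'] A' ⊗[k] Γ(X.left, (U j).1 ⊓ (U l).1 ⊓ (U m).1)),
      (∀ x, τjl (Φjl (ψ j l x)) = Φjl x) →
      Φjm (G j m) * (1 + ((e.symm 1 : ↥(J.restrictScalars k)) : A') ⊗ₜ s j l m) = Φjl (G j l) * τjl (Φlm (G l m)))
    (h : (j l : ι) → Γ(X.left, (U j).1 ⊓ (U l).1))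
    (hsh : ∀ j l m : ι, s j l m =
      X.left.presheaf.map (homOfLE (le_inf (inf_le_left.trans inf_le_right) inf_le_right :
          (U j).1 ⊓ (U l).1 ⊓ (U m).1 ≤ (U l).1 ⊓ (U m).1)).op (gi l m) *
        (show Γ(X.left, (U j).1 ⊓ (U l).1 ⊓ (U m).1) from
          appLE (restrictHom (homOfLE (inf_le_left : (U j).1 ⊓ (U l).1 ⊓ (U m).1 ≤ (U j).1 ⊓ (U l).1)) (θ j l)) (𝟙 _)
            (dSection X _ (X.left.presheaf.map (homOfLE (le_inf (inf_le_left.trans inf_le_right) inf_le_right :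
              (U j).1 ⊓ (U l).1 ⊓ (U m).1 ≤ (U l).1 ⊓ (U m).1)).op (g l m)))) +
      (X.left.presheaf.map (homOfLE (le_inf (inf_le_left.trans inf_le_left) inf_le_right :
          (U j).1 ⊓ (U l).1 ⊓ (U m).1 ≤ (U j).1 ⊓ (U m).1)).op (h j m) -
        X.left.presheaf.map (homOfLE (inf_le_left : (U j).1 ⊓ (U l).1 ⊓ (U m).1 ≤ (U j).1 ⊓ (U l).1)).op (h j l) -
        X.left.presheaf.map (homOfLE (le_inf (inf_le_left.trans inf_le_right) inf_le_right :
          (U j).1 ⊓ (U l).1 ⊓ (U m).1 ≤ (U l).1 ⊓ (U m).1)).op (h l m))) :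
    (∀ j l, G j l + ((e.symm 1 : ↥(J.restrictScalars k)) : A') ⊗ₜ (g j l * h j l) - (1 : A') ⊗ₜ g j l ∈
        𝔫' • (⊤ : Submodule A' (A' ⊗[k] Γ(X.left, (U j).1 ⊓ (U l).1)))) ∧
    ∀ (j l m : ι)
      (Φjl : A' ⊗[k] Γ(X.left, (U j).1 ⊓ (U l).1) →ₐ[A'] A' ⊗[k] Γ(X.left, (U j).1 ⊓ (U l).1 ⊓ (U m).1))
      (_ : ∀ a s, Φjl (a ⊗ₜ s) = a ⊗ₜ X.left.presheaf.map (homOfLE inf_le_left).op s)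
      (Φlm : A' ⊗[k] Γ(X.left, (U l).1 ⊓ (U m).1) →ₐ[A'] A' ⊗[k] Γ(X.left, (U j).1 ⊓ (U l).1 ⊓ (U m).1))
      (_ : ∀ a s, Φlm (a ⊗ₜ s) = a ⊗ₜ X.left.presheaf.map
        (homOfLE (le_inf (inf_le_left.trans inf_le_right) inf_le_right)).op s)
      (Φjm : A' ⊗[k] Γ(X.left, (U j).1 ⊓ (U m).1) →ₐ[A'] A' ⊗[k] Γ(X.left, (U j).1 ⊓ (U l).1 ⊓ (U m).1))
      (_ : ∀ a s, Φjm (a ⊗ₜ s) = a ⊗ₜ X.left.presheaf.map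
        (homOfLE (le_inf (inf_le_left.trans inf_le_left) inf_le_right)).op s)
      (τjl : A' ⊗[k] Γ(X.left, (U j).1 ⊓ (U l).1 ⊓ (U m).1) ≃ₐ[A'] A' ⊗[k] Γ(X.left, (U j).1 ⊓ (U l).1 ⊓ (U m).1)),
      (∀ x, τjl (Φjl ((u j l * ψ j l) x)) = Φjl x) →
      Φjm (G j m + ((e.symm 1 : ↥(J.restrictScalars k)) : A') ⊗ₜ (g j m * h j m)) =
        Φjl (G j l + ((e.symm 1 : ↥(J.restrictScalars k)) : A') ⊗ₜ (g j l * h j l)) *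
          τjl (Φlm (G l m + ((e.symm 1 : ↥(J.restrictScalars k)) : A') ⊗ₜ (g l m * h l m))) :=
  exact_correctedUnits_of_pairObstructionCochain_eq halg U b hb J 𝔫' e h𝔫 hJ hJ𝔫 hJle (fun j l => u j l * ψ j l)
    (fun j l => movedLifts_sub_mem J 𝔫' hJle (hu j l) (hψ j l)) G g hG hgcoc _
    (pairObstructionCochain_move halg J hJ e U b hb 𝔫' h𝔫 hJ𝔫 ψ hψ u hu θ hθ G g gi hgi hG hgcoc s hs) h
    (fun j l m => by rw [hsh]; abel)

end Move

end Literature.AlgebraicGeometry.Deformation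

end
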